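import Summits.CriticalPhenomena.PercolationContinuityZ3.Theorems.PercNearOneGluingNoHeavyLowerTailSahiCombTriWShell

/-!
# The PAIR-LOCAL PRINCIPLE for `TRI_W(a)`: a one-cube inequality on five up-sets that proves `TriWIneq` for EVERY index cube

Support file of the one-cut programme (crux `NoHeavyLowerTail`, stmt-CriticalPhenomena-4575; cell `prim-masterthm`, seat P5 gen 23;
memo `FROM-prim-masterthm-p5-g23-PAIR-LOCAL.md`).  Target of the lane: `FiveUpSet.TriWIneq` (`…SahiCombTriWGeneral`, OPEN for `a ≥ 2` in general).

By the pair decomposition (`FiveUpSet.two_mul_triW`) `2 · triW P F G = Σ_x triWOne P (F x) (F xᶜ) (G x) (G xᶜ)`, where the thin-edge functional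
`LatticeFiveUpSet.triWOne` is evaluated on the (in general NON-nested) pairs `(F x, F xᶜ)`, `(G x, G xᶜ)`.  Write `δ_x(u) = [u ∈ F x] − [u ∈ F xᶜ]`,
`ε_x(e) = [e ∈ G x] − [e ∈ G xᶜ]` (`FiveUpSet.sgnDiff`).  The KEY IDENTITY (`FiveUpSet.sum_sgnDiff_mul`) is

  `Σ_x δ_x(u) · ε_x(e) = 2 · (#(α_u ∩ β_e) − #(α_u ∩ refl β_e))`,   `α_u = idxSet F u`, `β_e = idxSet G e`,

twice a KLEITMAN GAP in the index cube (non-negative for monotone families, `card_inter_refl_le`).  Hence the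

**PAIR-LOCAL PRINCIPLE (`FiveUpSet.triW_nonneg_of_pairLocalCert`).**  If for an up-set-free weight `κ : W → W → ℕ` and `c > 0` the ONE-CUBE inequality

  `(PLC_P)   c · triWOne P F F' G G' ≥ Σ_{u,e} κ(u,e) · ([u ∈ F] − [u ∈ F']) · ([e ∈ G] − [e ∈ G'])`   for ALL up-sets `F, F', G, G'` of `W`

holds (`FiveUpSet.PairLocalCert P c κ`), then `0 ≤ triW P F G` for EVERY index cube `Finset β` and all monotone families of up-sets `F, G` — i.e.
`TriWIneq` for this `P` and every `a`.  (PLC_P) involves FIVE up-sets of ONE cube and no nestedness; for nested pairs it strengthens the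
five-up-set inequality, for general pairs it bounds the (possibly negative) thin-edge functional below by a signed bilinear form whose index-cube
average is a sum of Kleitman gaps.  Census/LP facts (memo §1–2, exact integer certificates, kit j163361/j163638): (PLC_P) holds with small integer
`κ` for EVERY up-set `P` of `2^n`, `n ≤ 3` (all `a` at once) — e.g. for `P = W \ {∅}`: `κ(u,uᶜ) = 1` (`u ≠ ∅, univ`), `κ(univ,univ) = 1`, `c = 1`.
This file proves the principle only (all `n`, all `a`); the instances are separate files.
HONEST LABEL: complete proofs, std axioms; a reduction (new proof architecture), not a proof of `TriWIneq`. [this work]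
-/

namespace Summit.CriticalPhenomena.PercolationContinuityZ3.Theorems

namespace FiveUpSet

open Finset

variable {β γ : Type} [DecidableEq β] [Fintype β] [DecidableEq γ] [Fintype γ]

/-! ### Signed indicator differences and the key identity -/

/-- The signed indicator difference of an ordered pair of families at a point: `sgnDiff F F' u = [u ∈ F] − [u ∈ F'] ∈ {−1,0,1}`. [this work] -/
def sgnDiff (F F' : Finset (Finset γ)) (u : Finset γ) : ℤ :=
  (if u ∈ F then 1 else 0) - (if u ∈ F' then 1 else 0)

omit [Fintype γ] in
/-- `Σ_x [u ∈ F x][e ∈ G x] = #(α_u ∩ β_e)`. [this work] -/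
theorem sum_ind_mul_ind (F G : Finset β → Finset (Finset γ)) (u e : Finset γ) :
    ∑ x : Finset β, (if u ∈ F x then (1 : ℤ) else 0) * (if e ∈ G x then (1 : ℤ) else 0)
      = ((idxSet F u ∩ idxSet G e).card : ℤ) := by
  have h : ∀ x : Finset β, (if u ∈ F x then (1 : ℤ) else 0) * (if e ∈ G x then (1 : ℤ) else 0)
      = if x ∈ idxSet F u ∩ idxSet G e then (1 : ℤ) else 0 := by
    intro x
    by_cases h1 : u ∈ F x <;> by_cases h2 : e ∈ G x <;> simp [h1, h2, mem_idxSet]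
  rw [Finset.sum_congr rfl (fun x _ => h x), Finset.sum_boole, Finset.filter_univ_mem]

omit [Fintype γ] in
/-- `Σ_x [u ∈ F x][e ∈ G xᶜ] = #(α_u ∩ refl β_e)`. [this work] -/
theorem sum_ind_mul_ind_compl (F G : Finset β → Finset (Finset γ)) (u e : Finset γ) :
    ∑ x : Finset β, (if u ∈ F x then (1 : ℤ) else 0) * (if e ∈ G xᶜ then (1 : ℤ) else 0)
      = ((idxSet F u ∩ refl (idxSet G e)).card : ℤ) := by
  have h : ∀ x : Finset β, (if u ∈ F x then (1 : ℤ) else 0) * (if e ∈ G xᶜ then (1 : ℤ) else 0)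
      = if x ∈ idxSet F u ∩ refl (idxSet G e) then (1 : ℤ) else 0 := by
    intro x
    by_cases h1 : u ∈ F x <;> by_cases h2 : e ∈ G xᶜ <;> simp [h1, h2, mem_idxSet, mem_refl]
  rw [Finset.sum_congr rfl (fun x _ => h x), Finset.sum_boole, Finset.filter_univ_mem]

omit [Fintype γ] in
/-- `Σ_x [u ∈ F xᶜ][e ∈ G x] = #(α_u ∩ refl β_e)` (re-index by the antipode of the index cube). [this work] -/
theorem sum_ind_compl_mul_ind (F G : Finset β → Finset (Finset γ)) (u e : Finset γ) :
    ∑ x : Finset β, (if u ∈ F xᶜ then (1 : ℤ) else 0) * (if e ∈ G x then (1 : ℤ) else 0)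
      = ((idxSet F u ∩ refl (idxSet G e)).card : ℤ) := by
  rw [← sum_ind_mul_ind_compl F G u e]
  refine Fintype.sum_equiv (complEquiv β) _ _ fun x => ?_
  show (if u ∈ F xᶜ then (1 : ℤ) else 0) * (if e ∈ G x then (1 : ℤ) else 0)
      = (if u ∈ F xᶜ then (1 : ℤ) else 0) * (if e ∈ G xᶜᶜ then (1 : ℤ) else 0)
  rw [compl_compl]

omit [Fintype γ] in
/-- `Σ_x [u ∈ F xᶜ][e ∈ G xᶜ] = #(α_u ∩ β_e)`. [this work] -/
theorem sum_ind_compl_mul_ind_compl (F G : Finset β → Finset (Finset γ)) (u e : Finset γ) :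
    ∑ x : Finset β, (if u ∈ F xᶜ then (1 : ℤ) else 0) * (if e ∈ G xᶜ then (1 : ℤ) else 0)
      = ((idxSet F u ∩ idxSet G e).card : ℤ) := by
  rw [← sum_ind_mul_ind F G u e]
  exact Fintype.sum_equiv (complEquiv β)
    (fun x => (if u ∈ F xᶜ then (1 : ℤ) else 0) * (if e ∈ G xᶜ then (1 : ℤ) else 0))
    (fun x => (if u ∈ F x then (1 : ℤ) else 0) * (if e ∈ G x then (1 : ℤ) else 0)) fun x => rfl

omit [Fintype γ] in
/-- **Key identity.**  Summed over the index cube, the product of the two signed pair differences is twice a Kleitman gap of the index profiles: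
`Σ_x ([u ∈ F x] − [u ∈ F xᶜ]) · ([e ∈ G x] − [e ∈ G xᶜ]) = 2 · (#(α_u ∩ β_e) − #(α_u ∩ refl β_e))`. [this work] -/
theorem sum_sgnDiff_mul (F G : Finset β → Finset (Finset γ)) (u e : Finset γ) :
    ∑ x : Finset β, sgnDiff (F x) (F xᶜ) u * sgnDiff (G x) (G xᶜ) e
      = 2 * (((idxSet F u ∩ idxSet G e).card : ℤ) - (idxSet F u ∩ refl (idxSet G e)).card) := by
  have hx : ∀ x : Finset β, sgnDiff (F x) (F xᶜ) u * sgnDiff (G x) (G xᶜ) e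
      = (((if u ∈ F x then (1 : ℤ) else 0) * (if e ∈ G x then (1 : ℤ) else 0)
        - (if u ∈ F x then (1 : ℤ) else 0) * (if e ∈ G xᶜ then (1 : ℤ) else 0))
        - (if u ∈ F xᶜ then (1 : ℤ) else 0) * (if e ∈ G x then (1 : ℤ) else 0))
        + (if u ∈ F xᶜ then (1 : ℤ) else 0) * (if e ∈ G xᶜ then (1 : ℤ) else 0) := by
    intro x; unfold sgnDiff; ring
  rw [Finset.sum_congr rfl (fun x _ => hx x), sum_add_distrib, sum_sub_distrib, sum_sub_distrib,
    sum_ind_mul_ind F G u e, sum_ind_mul_ind_compl F G u e, sum_ind_compl_mul_ind F G u e, sum_ind_compl_mul_ind_compl F G u e]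
  ring

omit [Fintype γ] in
/-- The index-cube average of a signed pair product is non-negative for MONOTONE families (Kleitman's lemma in the index cube). [this work] -/
theorem sum_sgnDiff_mul_nonneg {F G : Finset β → Finset (Finset γ)} (hFm : Monotone F) (hGm : Monotone G) (u e : Finset γ) :
    0 ≤ ∑ x : Finset β, sgnDiff (F x) (F xᶜ) u * sgnDiff (G x) (G xᶜ) e := by
  rw [sum_sgnDiff_mul]
  have h := card_inter_refl_le (isUpperSet_idxSet hFm u) (isUpperSet_idxSet hGm e)
  omega

/-! ### The pair-local certificate and the principle -/

/-- **The pair-local certificate property (PLC_P).**  For a family `P` (the test up-set), a multiplier `c` and a weight `κ : W → W → ℕ`: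
for ALL up-sets `F, F', G, G'` of the cube `W = Finset γ` (no nestedness assumed),
`Σ_u Σ_e κ(u,e) · ([u ∈ F] − [u ∈ F']) · ([e ∈ G] − [e ∈ G']) ≤ c · triWOne P F F' G G'`
(`triWOne` = the thin-edge functional of `…SahiCombFiveUpSetTriW` with the complementation antipode). [this work] -/
def PairLocalCert (P : Finset (Finset γ)) (c : ℕ) (κ : Finset γ → Finset γ → ℕ) : Prop :=
  ∀ F F' G G' : Finset (Finset γ),
    IsUpperSet (F : Set (Finset γ)) → IsUpperSet (F' : Set (Finset γ)) →
    IsUpperSet (G : Set (Finset γ)) → IsUpperSet (G' : Set (Finset γ)) →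
      ∑ u : Finset γ, ∑ e : Finset γ, (κ u e : ℤ) * sgnDiff F F' u * sgnDiff G G' e
        ≤ (c : ℤ) * LatticeFiveUpSet.triWOne (complEquiv γ) P F F' G G'

/-- **The pair-local principle.**  A pair-local certificate for `P` (with `c > 0`) gives `0 ≤ triW P F G` for EVERY index cube `Finset β` and all
monotone families `F, G` of up-sets of `W`.  Proof: sum (PLC_P) over the antipodal pairs `(x, xᶜ)` of the index cube; the left-hand sides add up,
by `sum_sgnDiff_mul`, to `Σ_{u,e} κ(u,e) · 2 · (Kleitman gap of α_u, β_e) ≥ 0`, the right-hand sides to `c · 2 · triW P F G` (`two_mul_triW`). [this work] -/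
theorem triW_nonneg_of_pairLocalCert {P : Finset (Finset γ)} {c : ℕ} {κ : Finset γ → Finset γ → ℕ}
    (hc : 0 < c) (hcert : PairLocalCert P c κ) (F G : Finset β → Finset (Finset γ))
    (hF : ∀ x, IsUpperSet (F x : Set (Finset γ))) (hG : ∀ x, IsUpperSet (G x : Set (Finset γ)))
    (hFm : Monotone F) (hGm : Monotone G) :
    0 ≤ triW P F G := by
  -- sum the certificate over the index cube
  have hsum : ∑ x : Finset β, ∑ u : Finset γ, ∑ e : Finset γ,
        (κ u e : ℤ) * sgnDiff (F x) (F xᶜ) u * sgnDiff (G x) (G xᶜ) e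
      ≤ ∑ x : Finset β, (c : ℤ) * LatticeFiveUpSet.triWOne (complEquiv γ) P (F x) (F xᶜ) (G x) (G xᶜ) :=
    sum_le_sum fun x _ => hcert (F x) (F xᶜ) (G x) (G xᶜ) (hF x) (hF xᶜ) (hG x) (hG xᶜ)
  -- the right-hand side is `2c · triW`
  have hR : ∑ x : Finset β, (c : ℤ) * LatticeFiveUpSet.triWOne (complEquiv γ) P (F x) (F xᶜ) (G x) (G xᶜ)
      = (c : ℤ) * (2 * triW P F G) := by
    rw [two_mul_triW, mul_sum]
  -- the left-hand side is a non-negative combination of Kleitman gaps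
  have hL : 0 ≤ ∑ x : Finset β, ∑ u : Finset γ, ∑ e : Finset γ,
        (κ u e : ℤ) * sgnDiff (F x) (F xᶜ) u * sgnDiff (G x) (G xᶜ) e := by
    rw [sum_comm]
    refine sum_nonneg fun u _ => ?_
    rw [sum_comm]
    refine sum_nonneg fun e _ => ?_
    have hk : ∑ x : Finset β, (κ u e : ℤ) * sgnDiff (F x) (F xᶜ) u * sgnDiff (G x) (G xᶜ) e
        = (κ u e : ℤ) * ∑ x : Finset β, sgnDiff (F x) (F xᶜ) u * sgnDiff (G x) (G xᶜ) e := by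
      rw [mul_sum]
      refine sum_congr rfl fun x _ => ?_
      ring
    rw [hk]
    exact mul_nonneg (by exact_mod_cast Nat.zero_le _) (sum_sgnDiff_mul_nonneg hFm hGm u e)
  have h2 : 0 ≤ (c : ℤ) * (2 * triW P F G) := by rw [← hR]; exact hL.trans hsum
  have hc' : (0 : ℤ) < c := by exact_mod_cast hc
  nlinarith

/-- The principle in `TriWIneq` shape: pair-local certificates for every up-set `P` of a fibre cube `Finset γ` give `TriWIneq` on every cell
`(a, #γ)`, all `a`. [this work] -/
theorem triW_nonneg_of_forall_pairLocalCert
    (h : ∀ P : Finset (Finset γ), IsUpperSet (P : Set (Finset γ)) → ∃ c κ, 0 < c ∧ PairLocalCert P c κ)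
    (P : Finset (Finset γ)) (hP : IsUpperSet (P : Set (Finset γ))) (F G : Finset β → Finset (Finset γ))
    (hF : ∀ x, IsUpperSet (F x : Set (Finset γ))) (hG : ∀ x, IsUpperSet (G x : Set (Finset γ)))
    (hFm : Monotone F) (hGm : Monotone G) :
    0 ≤ triW P F G := by
  obtain ⟨c, κ, hc, hcert⟩ := h P hP
  exact triW_nonneg_of_pairLocalCert hc hcert F G hF hG hFm hGm

end FiveUpSet

end Summit.CriticalPhenomena.PercolationContinuityZ3.Theorems
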